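import Summits.ValiantsHypothesis.ValiantsHypothesis.Theorems.KPlusLogSqLawValuativeDoorVirtual
import Summits.ValiantsHypothesis.ValiantsHypothesis.Theorems.KPlusLogSqLawValuativeDoorTwoFourAntiMonge

/-!
# LINE `valuative_door` (crux `WeakLifting`, stmt-ValiantsHypothesis-19561) — the calibration `ValTwoFourCalibration` (v(2,4) = 8 < ζ(2,4) = 9):
# every symmetric `2 × 2` lacunary pencil with four letters has at most `8` Newton edges over any non-archimedean field

HONEST FRAMING.  Helper (cell `pub-symmetroid`, seat val-sym-lift-p1 g22, 2026-08-29; `--supports 19561 --as helper`).  The skeleton's calibration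
target `ValTwoFourCalibration : ValRootLawAt 2 4 8` (crit-6 g4 VERDICT #54 (g), «the ninth real root at (2,4) is an amoeba root») PROVED in
unfolded form (`valTwoFourCalibration_unfolded`).  The determinant of `Σ_{l<4} X^{d_l} S_l` (`S_l` symmetric `2 × 2`) is
`Σ_{l,l'} (a_l c_{l'} − b_l b_{l'}) X^{d_l + d_{l'}}` (`det_symmPencil_two`), supported on the at most ten sums `d_l + d_{l'}`; ten dominant
exponents would force the ten sums to be distinct with the coefficients `G_{ll'} = a_l c_{l'} + a_{l'} c_l − 2 b_l b_{l'}` (`l ≠ l'`) and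
`G_{ll}/2` all dominant, hence a STRICTLY CONCAVE profile `log v` along equal sums (`concave_of_dominant`); by the anti-Monge lemma
(`…TwoFourAntiMonge.sum_perm_lt_sum_rev`) the reversal `(0 3)(1 2)` is then the unique `v`-largest Leibniz term of `det G` (`v 2 ≤ 1` only helps
on fixed points), so `v(det G) = v(G₀₃)² v(G₁₂)² > 0` — contradicting the Gram identity `det G = 0` (`det_gram_polarDet_eq_zero`: four vectors
in the 3-space of symmetric `2 × 2` matrices).  Hence `domCount ≤ 9`, `npEdges ≤ 8`.  Calibration only (bounded format); no bearing on vW / vB,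
`TropicalB`, `MatrixDescartes` (18050) or VP ≠ VNP.  [crit-6's anti-Monge argument; elementary]
-/

set_option linter.dupNamespace false
set_option autoImplicit false

namespace Summit.ValiantsHypothesis.ValiantsHypothesis.Theorems.KPlusLogSqLaw.ValDoor

open Polynomial Finset Matrix
open scoped BigOperators Classical

variable {F : Type*} [Field F]

/-! ## §1 The determinant of a symmetric `2 × 2` lacunary pencil -/

/-- entries of a lacunary pencil. [bookkeeping] -/
theorem pencil_apply {m K : ℕ} (d : Fin K → ℕ) (S : Fin K → Matrix (Fin m) (Fin m) F) (i j : Fin m) :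
    (∑ l, ((X : F[X]) ^ d l) • (S l).map (C : F →+* F[X])) i j = ∑ l, C (S l i j) * X ^ d l := by
  rw [Matrix.sum_apply]
  refine Finset.sum_congr rfl fun l _ => ?_
  rw [Matrix.smul_apply, Matrix.map_apply, smul_eq_mul, mul_comm]

/-- **`det Σ_l X^{d_l} S_l = Σ_{l,l'} (a_l c_{l'} − b_l b_{l'}) X^{d_l + d_{l'}}`** for symmetric `2 × 2` letters
(`a = S 0 0`, `b = S 0 1 = S 1 0`, `c = S 1 1`). [bookkeeping: `Matrix.det_fin_two`] -/
theorem det_symmPencil_two {K : ℕ} (d : Fin K → ℕ) (S : Fin K → Matrix (Fin 2) (Fin 2) F) (hS : ∀ l, (S l).IsSymm) :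
    Matrix.det (∑ l, ((X : F[X]) ^ d l) • (S l).map (C : F →+* F[X]))
      = ∑ p : Fin K × Fin K, C (S p.1 0 0 * S p.2 1 1 - S p.1 0 1 * S p.2 0 1) * X ^ (d p.1 + d p.2) := by
  rw [Matrix.det_fin_two, pencil_apply, pencil_apply, pencil_apply, pencil_apply]
  have hb : ∀ l, S l 1 0 = S l 0 1 := fun l => by
    have := (hS l).apply 0 1
    exact this
  simp only [hb]
  rw [Finset.sum_mul_sum, Finset.sum_mul_sum, ← Finset.sum_sub_distrib, Fintype.sum_prod_type]
  refine Finset.sum_congr rfl fun x _ => ?_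
  rw [← Finset.sum_sub_distrib]
  refine Finset.sum_congr rfl fun y _ => ?_
  rw [map_sub, map_mul, map_mul, pow_add]
  ring

/-- the coefficient at `E`: the sum of `a_l c_{l'} − b_l b_{l'}` over the ordered pairs with `d_l + d_{l'} = E`. [bookkeeping] -/
theorem coeff_det_symmPencil_two {K : ℕ} (d : Fin K → ℕ) (S : Fin K → Matrix (Fin 2) (Fin 2) F) (hS : ∀ l, (S l).IsSymm) (E : ℕ) :
    (Matrix.det (∑ l, ((X : F[X]) ^ d l) • (S l).map (C : F →+* F[X]))).coeff E
      = ∑ p ∈ (univ : Finset (Fin K × Fin K)).filter (fun p => d p.1 + d p.2 = E),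
          (S p.1 0 0 * S p.2 1 1 - S p.1 0 1 * S p.2 0 1) := by
  rw [det_symmPencil_two d S hS, Polynomial.finsetSum_coeff]
  simp only [Polynomial.coeff_C_mul_X_pow]
  rw [Finset.sum_filter]
  refine Finset.sum_congr rfl fun p _ => ?_
  by_cases h : d p.1 + d p.2 = E
  · rw [if_pos h, if_pos h.symm]
  · rw [if_neg h, if_neg (fun h' => h h'.symm)]

/-- under DISTINCT PAIR SUMS the off-diagonal coefficient is the polarised determinant `G_{ij} = a_i c_j + a_j c_i − 2 b_i b_j`. [bookkeeping] -/
theorem coeff_offdiag_of_sidon (d : Fin 4 → ℕ) (S : Fin 4 → Matrix (Fin 2) (Fin 2) F) (hS : ∀ l, (S l).IsSymm)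
    (hsid : ∀ l₁ l₂ l₃ l₄ : Fin 4, d l₁ + d l₂ = d l₃ + d l₄ → (l₁ = l₃ ∧ l₂ = l₄) ∨ (l₁ = l₄ ∧ l₂ = l₃))
    {i j : Fin 4} (hij : i ≠ j) :
    (Matrix.det (∑ l, ((X : F[X]) ^ d l) • (S l).map (C : F →+* F[X]))).coeff (d i + d j)
      = S i 0 0 * S j 1 1 + S j 0 0 * S i 1 1 - 2 * S i 0 1 * S j 0 1 := by
  rw [coeff_det_symmPencil_two d S hS]
  have hfilter : (univ : Finset (Fin 4 × Fin 4)).filter (fun p => d p.1 + d p.2 = d i + d j) = {(i, j), (j, i)} := by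
    ext p
    simp only [Finset.mem_filter, Finset.mem_univ, true_and, Finset.mem_insert, Finset.mem_singleton]
    constructor
    · intro h
      rcases hsid p.1 p.2 i j h with ⟨h1, h2⟩ | ⟨h1, h2⟩
      · left; exact Prod.ext h1 h2
      · right; exact Prod.ext h1 h2
    · rintro (rfl | rfl)
      · rfl
      · exact Nat.add_comm _ _
  rw [hfilter, Finset.sum_pair (fun h => hij (Prod.mk.inj h).1)]
  ring

/-- under distinct pair sums the diagonal coefficient is `a_i c_i − b_i²` (= `G_{ii}/2`). [bookkeeping] -/
theorem coeff_diag_of_sidon (d : Fin 4 → ℕ) (S : Fin 4 → Matrix (Fin 2) (Fin 2) F) (hS : ∀ l, (S l).IsSymm)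
    (hsid : ∀ l₁ l₂ l₃ l₄ : Fin 4, d l₁ + d l₂ = d l₃ + d l₄ → (l₁ = l₃ ∧ l₂ = l₄) ∨ (l₁ = l₄ ∧ l₂ = l₃)) (i : Fin 4) :
    (Matrix.det (∑ l, ((X : F[X]) ^ d l) • (S l).map (C : F →+* F[X]))).coeff (d i + d i)
      = S i 0 0 * S i 1 1 - S i 0 1 * S i 0 1 := by
  rw [coeff_det_symmPencil_two d S hS]
  have hfilter : (univ : Finset (Fin 4 × Fin 4)).filter (fun p => d p.1 + d p.2 = d i + d i) = {(i, i)} := by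
    ext p
    simp only [Finset.mem_filter, Finset.mem_univ, true_and, Finset.mem_singleton]
    constructor
    · intro h
      rcases hsid p.1 p.2 i i h with ⟨h1, h2⟩ | ⟨h1, h2⟩
      · exact Prod.ext h1 h2
      · exact Prod.ext h1 h2
    · rintro rfl; rfl
  rw [hfilter, Finset.sum_singleton]

/-! ## §2 Dominance makes the valuation profile strictly concave along equal exponent sums -/

/-- **outer pair < inner pair:** if `A + D = B + C` with `A < B`, `A < C` are support exponents and `B`, `C` are DOMINANT, then
`log v(c_A) + log v(c_D) < log v(c_B) + log v(c_C)`. [elementary: compare at the slopes witnessing `B` and `C`] -/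
theorem concave_of_dominant (v : AbsoluteValue F ℝ) (f : F[X]) {A B Cx D : ℕ} (hA : A ∈ f.support) (hD : D ∈ f.support)
    (hB : B ∈ f.support) (hC : Cx ∈ f.support)
    (hBdom : ∃ r : ℝ, 0 < r ∧ ∀ E' ∈ f.support, E' ≠ B → v (f.coeff E') * r ^ E' < v (f.coeff B) * r ^ B)
    (hCdom : ∃ r : ℝ, 0 < r ∧ ∀ E' ∈ f.support, E' ≠ Cx → v (f.coeff E') * r ^ E' < v (f.coeff Cx) * r ^ Cx)
    (hsum : A + D = B + Cx) (hAB : A < B) (hAC : A < Cx) :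
    Real.log (v (f.coeff A)) + Real.log (v (f.coeff D)) < Real.log (v (f.coeff B)) + Real.log (v (f.coeff Cx)) := by
  obtain ⟨sB, hsB⟩ := (exists_dominant_iff_exists_slope v f hB).1 hBdom
  obtain ⟨sC, hsC⟩ := (exists_dominant_iff_exists_slope v f hC).1 hCdom
  have hDB : D ≠ B := by omega
  have hDC : D ≠ Cx := by omega
  have hreal : (D : ℝ) = (B : ℝ) + (Cx : ℝ) - (A : ℝ) := by
    have := congrArg (Nat.cast : ℕ → ℝ) hsum
    push_cast at this
    linarith
  have hAB' : (A : ℝ) < B := by exact_mod_cast hAB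
  have hAC' : (A : ℝ) < Cx := by exact_mod_cast hAC
  rcases le_total sB sC with hle | hle
  · have h1 := hsB A hA (ne_of_lt hAB)
    have h2 := hsC D hD hDC
    have h3 : ((B : ℝ) - A) * (sB - sC) ≤ 0 := mul_nonpos_of_nonneg_of_nonpos (by linarith) (by linarith)
    rw [hreal] at h2
    nlinarith [h1, h2, h3]
  · have h1 := hsB D hD hDB
    have h2 := hsC A hA (ne_of_lt hAC)
    have h3 : ((Cx : ℝ) - A) * (sC - sB) ≤ 0 := mul_nonpos_of_nonneg_of_nonpos (by linarith) (by linarith)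
    rw [hreal] at h1
    nlinarith [h1, h2, h3]

/-! ## §3 Ten dominant exponents are impossible (sorted letters, distinct pair sums) -/

/-- a non-archimedean absolute value has `v 2 ≤ 1`. [folklore] -/
theorem abv_two_le_one (v : AbsoluteValue F ℝ) (hv : IsNonarchimedean v) : v 2 ≤ 1 := by
  have h := hv 1 1
  rw [one_add_one_eq_two, map_one, max_self] at h
  exact h

/-- **TEN DOMINANT EXPONENTS ARE IMPOSSIBLE** for a symmetric `2 × 2` pencil with four letters of strictly increasing exponents and distinct
pair sums: the reversal term of the Gram determinant would be its unique `v`-largest Leibniz term, contradicting `det G = 0`.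
[crit-6's anti-Monge argument] -/
theorem not_ten_dominant_two_four (v : AbsoluteValue F ℝ) (hv : IsNonarchimedean v) (d : Fin 4 → ℕ) (hd : StrictMono d)
    (S : Fin 4 → Matrix (Fin 2) (Fin 2) F) (hS : ∀ l, (S l).IsSymm)
    (hsid : ∀ l₁ l₂ l₃ l₄ : Fin 4, d l₁ + d l₂ = d l₃ + d l₄ → (l₁ = l₃ ∧ l₂ = l₄) ∨ (l₁ = l₄ ∧ l₂ = l₃))
    (hall : ∀ i j : Fin 4, (d i + d j) ∈ (Matrix.det (∑ l, ((X : F[X]) ^ d l) • (S l).map (C : F →+* F[X]))).support ∧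
      ∃ r : ℝ, 0 < r ∧ ∀ E' ∈ (Matrix.det (∑ l, ((X : F[X]) ^ d l) • (S l).map (C : F →+* F[X]))).support, E' ≠ d i + d j →
        v ((Matrix.det (∑ l, ((X : F[X]) ^ d l) • (S l).map (C : F →+* F[X]))).coeff E') * r ^ E'
          < v ((Matrix.det (∑ l, ((X : F[X]) ^ d l) • (S l).map (C : F →+* F[X]))).coeff (d i + d j)) * r ^ (d i + d j)) :
    False := by
  set f : F[X] := Matrix.det (∑ l, ((X : F[X]) ^ d l) • (S l).map (C : F →+* F[X])) with hf
  set G : Matrix (Fin 4) (Fin 4) F := Matrix.of fun l l' : Fin 4 => S l 0 0 * S l' 1 1 + S l' 0 0 * S l 1 1 - 2 * S l 0 1 * S l' 0 1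
    with hG
  have hdet : G.det = 0 := det_gram_polarDet_eq_zero (fun l => S l 0 0) (fun l => S l 0 1) (fun l => S l 1 1)
  set x : Fin 4 → Fin 4 → ℝ := fun i j => Real.log (v (f.coeff (d i + d j))) with hx
  have hxsymm : ∀ i j, x i j = x j i := fun i j => by simp only [hx, Nat.add_comm]
  have hpos : ∀ i j, 0 < v (f.coeff (d i + d j)) := fun i j => v.pos (Polynomial.mem_support_iff.1 (hall i j).1)
  -- the entries of G against the coefficients
  have hGoff : ∀ i j, i ≠ j → G i j = f.coeff (d i + d j) := by
    intro i j hij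
    rw [hG, Matrix.of_apply, hf, coeff_offdiag_of_sidon d S hS hsid hij]
  have hGdiag : ∀ i, G i i = 2 * f.coeff (d i + d i) := by
    intro i
    rw [hG, Matrix.of_apply, hf, coeff_diag_of_sidon d S hS hsid i]
    ring
  have hvG : ∀ i j, v (G i j) ≤ Real.exp (x i j) := by
    intro i j
    by_cases hij : i = j
    · subst hij
      rw [hGdiag, map_mul, hx]
      simp only []
      rw [Real.exp_log (hpos i i)]
      exact (mul_le_of_le_one_left (v.nonneg _) (abv_two_le_one v hv))
    · rw [hGoff i j hij, hx]
      simp only []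
      rw [Real.exp_log (hpos i j)]
  have hvGeq : ∀ i j, i ≠ j → v (G i j) = Real.exp (x i j) := by
    intro i j hij
    rw [hGoff i j hij, hx]
    simp only []
    rw [Real.exp_log (hpos i j)]
  -- strict concavity along equal sums
  have hconc : ∀ p₁ q₁ p₂ q₂ p₃ q₃ p₄ q₄ : Fin 4,
      d p₁ + d q₁ + (d p₄ + d q₄) = d p₂ + d q₂ + (d p₃ + d q₃) →
      d p₁ + d q₁ < d p₂ + d q₂ → d p₁ + d q₁ < d p₃ + d q₃ → x p₁ q₁ + x p₄ q₄ < x p₂ q₂ + x p₃ q₃ := by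
    intro p₁ q₁ p₂ q₂ p₃ q₃ p₄ q₄ hsum h12 h13
    exact concave_of_dominant v f (hall p₁ q₁).1 (hall p₄ q₄).1 (hall p₂ q₂).1 (hall p₃ q₃).1 (hall p₂ q₂).2 (hall p₃ q₃).2
      hsum h12 h13
  -- Leibniz terms and their sizes
  have hterm : ∀ σ : Equiv.Perm (Fin 4), v (Equiv.Perm.sign σ • ∏ l, G (σ l) l) = ∏ l, v (G (σ l) l) := by
    intro σ
    rcases Int.units_eq_one_or (Equiv.Perm.sign σ) with h | h
    · rw [h, one_smul, map_prod]
    · rw [h, Units.neg_smul, one_smul, AbsoluteValue.map_neg, map_prod]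
  have hle : ∀ σ : Equiv.Perm (Fin 4), ∏ l, v (G (σ l) l) ≤ Real.exp (∑ l, x l (σ l)) := by
    intro σ
    rw [Real.exp_sum]
    refine Finset.prod_le_prod (fun l _ => v.nonneg _) fun l _ => ?_
    rw [hxsymm]
    exact hvG (σ l) l
  have hrev_ne : ∀ l : Fin 4, Fin.revPerm l ≠ l := by
    intro l h
    have := congrArg Fin.val h
    rw [Fin.revPerm_apply, Fin.val_rev] at this
    omega
  have heq : ∏ l, v (G (Fin.revPerm l) l) = Real.exp (∑ l, x l (Fin.revPerm l)) := by
    rw [Real.exp_sum]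
    refine Finset.prod_congr rfl fun l _ => ?_
    rw [hxsymm]
    exact hvGeq _ _ (hrev_ne l)
  -- the reversal is the unique largest term
  have hmax : ∀ σ ∈ (univ : Finset (Equiv.Perm (Fin 4))), σ ≠ Fin.revPerm →
      v (Equiv.Perm.sign σ • ∏ l, G (σ l) l)
        < v (Equiv.Perm.sign (Fin.revPerm : Equiv.Perm (Fin 4)) • ∏ l, G ((Fin.revPerm : Equiv.Perm (Fin 4)) l) l) := by
    intro σ _ hσ
    rw [hterm, hterm, heq]
    refine lt_of_le_of_lt (hle σ) (Real.exp_lt_exp.2 ?_)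
    exact sum_perm_lt_sum_rev x d hd hconc _ σ le_rfl hσ
  have hsum := abv_sum_eq_of_unique_max v hv (univ : Finset (Equiv.Perm (Fin 4)))
    (fun σ => Equiv.Perm.sign σ • ∏ l, G (σ l) l) (Finset.mem_univ (Fin.revPerm : Equiv.Perm (Fin 4))) hmax
  rw [← Matrix.det_apply, hdet, map_zero, hterm, heq] at hsum
  exact absurd hsum (ne_of_lt (Real.exp_pos _))

/-! ## §4 `ValTwoFourCalibration`, unfolded -/

/-- **`ValTwoFourCalibration` (= `ValRootLawAt 2 4 8`) UNFOLDED:** every symmetric `2 × 2` lacunary pencil with four letters over a field of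
characteristic zero with a non-archimedean absolute value has `npEdges ≤ 8` (at most `9` dominant exponents out of the at most `10` support
exponents). [crit-6 g4's anti-Monge argument, kernel] -/
theorem valTwoFourCalibration_unfolded :
    ∀ (F : Type) [Field F] [CharZero F] (v : AbsoluteValue F ℝ), IsNonarchimedean v →
      ∀ (d : Fin 4 → ℕ) (S : Fin 4 → Matrix (Fin 2) (Fin 2) F), (∀ l, (S l).IsSymm) →
        ((Matrix.det (∑ l, ((Polynomial.X : Polynomial F) ^ d l) • (S l).map Polynomial.C)).support.filter fun E =>
            ∃ r : ℝ, 0 < r ∧ ∀ E' ∈ (Matrix.det (∑ l, ((Polynomial.X : Polynomial F) ^ d l) • (S l).map Polynomial.C)).support,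
              E' ≠ E →
              v ((Matrix.det (∑ l, ((Polynomial.X : Polynomial F) ^ d l) • (S l).map Polynomial.C)).coeff E') * r ^ E'
                < v ((Matrix.det (∑ l, ((Polynomial.X : Polynomial F) ^ d l) • (S l).map Polynomial.C)).coeff E) * r ^ E).card - 1
          ≤ 8 := by
  intro F _ _ v hv d S hS
  set f : F[X] := Matrix.det (∑ l, ((X : F[X]) ^ d l) • (S l).map (C : F →+* F[X])) with hf
  set D := f.support.filter fun E => ∃ r : ℝ, 0 < r ∧ ∀ E' ∈ f.support, E' ≠ E →
      v (f.coeff E') * r ^ E' < v (f.coeff E) * r ^ E with hD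
  suffices h9 : D.card ≤ 9 by omega
  -- the ten pair sums, indexed by unordered pairs
  set Pairs : Finset (Sym2 (Fin 4)) := (univ : Finset (Fin 4)).sym2 with hPairs
  set psum : Sym2 (Fin 4) → ℕ := Sym2.lift ⟨fun i j => d i + d j, fun i j => Nat.add_comm _ _⟩ with hpsum
  have hpsum_mk : ∀ i j, psum s(i, j) = d i + d j := fun i j => by rw [hpsum, Sym2.lift_mk]
  set T : Finset ℕ := Pairs.image psum with hT
  have hpairs : Pairs.card = 10 := by
    rw [hPairs, Finset.card_sym2, Finset.card_univ, Fintype.card_fin]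
    rfl
  have hTcard : T.card ≤ 10 := hpairs ▸ Finset.card_image_le
  have hmemPairs : ∀ i j : Fin 4, s(i, j) ∈ Pairs := fun i j =>
    Finset.mk_mem_sym2_iff.2 ⟨Finset.mem_univ _, Finset.mem_univ _⟩
  have hsuppT : f.support ⊆ T := by
    intro E hE
    have hne := Polynomial.mem_support_iff.1 hE
    rw [hf, coeff_det_symmPencil_two d S hS E] at hne
    obtain ⟨p, hp, -⟩ := Finset.exists_ne_zero_of_sum_ne_zero hne
    obtain ⟨-, hpE⟩ := Finset.mem_filter.1 hp
    exact Finset.mem_image.2 ⟨s(p.1, p.2), hmemPairs _ _, by rw [hpsum_mk, hpE]⟩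
  have hDT : D ⊆ T := (Finset.filter_subset _ _).trans hsuppT
  by_contra h10
  have hD10 : D.card = 10 := le_antisymm ((Finset.card_le_card hDT).trans hTcard) (by omega)
  have hT10 : T.card = 10 := le_antisymm hTcard (hD10 ▸ Finset.card_le_card hDT)
  have hDeqT : D = T := Finset.eq_of_subset_of_card_le hDT (by rw [hD10, hT10])
  -- distinct pair sums
  have hinjOn : Set.InjOn psum (Pairs : Set (Sym2 (Fin 4))) := Finset.card_image_iff.1 (by rw [← hT, hT10, hpairs])
  have hsid : ∀ l₁ l₂ l₃ l₄ : Fin 4, d l₁ + d l₂ = d l₃ + d l₄ → (l₁ = l₃ ∧ l₂ = l₄) ∨ (l₁ = l₄ ∧ l₂ = l₃) := by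
    intro l₁ l₂ l₃ l₄ h
    have h' : psum s(l₁, l₂) = psum s(l₃, l₄) := by rw [hpsum_mk, hpsum_mk, h]
    exact Sym2.eq_iff.1 (hinjOn (Finset.mem_coe.2 (hmemPairs _ _)) (Finset.mem_coe.2 (hmemPairs _ _)) h')
  have hdinj : Function.Injective d := by
    intro i j hij
    rcases hsid i i i j (by rw [hij]) with ⟨-, h⟩ | ⟨h, -⟩
    · exact h
    · exact h
  -- sort the letters
  set σ : Equiv.Perm (Fin 4) := Tuple.sort d with hσ
  have hmono : StrictMono (d ∘ σ) := (Tuple.monotone_sort d).strictMono_of_injective (hdinj.comp σ.injective)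
  have hS' : ∀ l, (S (σ l)).IsSymm := fun l => hS (σ l)
  have hsid' : ∀ l₁ l₂ l₃ l₄ : Fin 4, (d ∘ σ) l₁ + (d ∘ σ) l₂ = (d ∘ σ) l₃ + (d ∘ σ) l₄ →
      (l₁ = l₃ ∧ l₂ = l₄) ∨ (l₁ = l₄ ∧ l₂ = l₃) := by
    intro l₁ l₂ l₃ l₄ h
    rcases hsid _ _ _ _ h with ⟨h1, h2⟩ | ⟨h1, h2⟩
    · exact Or.inl ⟨σ.injective h1, σ.injective h2⟩
    · exact Or.inr ⟨σ.injective h1, σ.injective h2⟩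
  have hf' : Matrix.det (∑ l, ((X : F[X]) ^ (d ∘ σ) l) • (S (σ l)).map (C : F →+* F[X])) = f := by
    rw [hf]
    exact congrArg Matrix.det (Equiv.sum_comp σ (fun l => ((X : F[X]) ^ d l) • (S l).map (C : F →+* F[X])))
  have hall' : ∀ i j : Fin 4,
      ((d ∘ σ) i + (d ∘ σ) j) ∈ (Matrix.det (∑ l, ((X : F[X]) ^ (d ∘ σ) l) • (S (σ l)).map (C : F →+* F[X]))).support ∧
      ∃ r : ℝ, 0 < r ∧ ∀ E' ∈ (Matrix.det (∑ l, ((X : F[X]) ^ (d ∘ σ) l) • (S (σ l)).map (C : F →+* F[X]))).support,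
        E' ≠ (d ∘ σ) i + (d ∘ σ) j →
        v ((Matrix.det (∑ l, ((X : F[X]) ^ (d ∘ σ) l) • (S (σ l)).map (C : F →+* F[X]))).coeff E') * r ^ E'
          < v ((Matrix.det (∑ l, ((X : F[X]) ^ (d ∘ σ) l) • (S (σ l)).map (C : F →+* F[X]))).coeff ((d ∘ σ) i + (d ∘ σ) j))
            * r ^ ((d ∘ σ) i + (d ∘ σ) j) := by
    intro i j
    rw [hf']
    have hET : d (σ i) + d (σ j) ∈ T := Finset.mem_image.2 ⟨s(σ i, σ j), hmemPairs _ _, hpsum_mk _ _⟩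
    rw [← hDeqT] at hET
    exact Finset.mem_filter.1 hET
  exact not_ten_dominant_two_four v hv (d ∘ σ) hmono (fun l => S (σ l)) hS' hsid' hall'

end Summit.ValiantsHypothesis.ValiantsHypothesis.Theorems.KPlusLogSqLaw.ValDoor
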